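import Mathlib
import Summits.ValiantsHypothesis.ValiantsHypothesis.Theorems.StableRankCancellationSmlPairs
import HarnessLib

/-!
# Route StableRankCancellation — the spike lemma (item stmt-ValiantsHypothesis-10614)

`SpikeLemma`: if `T = Σ_i g_i h_i` (finite index type `ι`) with `g_i` set-multilinear over `S_i`
and `h_i` over `S_iᶜ`, `T ≠ 0`, then for some `i` and test vectors `a, b`:
`aᵀ M_{S_i}(T) b ≠ 0` and `‖T‖⁴ ‖a‖² ‖b‖² ≤ |ι| · (Σ_i ‖g_i h_i‖²) · |aᵀ M_{S_i}(T) b|²`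
(`‖·‖²` = sum of squared moduli of coefficients, `M_S` = the tree's `coeffMat ℂ S Sᶜ`).

Proof (as on the card). Test vectors `a_i = conj(coefficients of g_i)`, `b_i = conj(coeff. of h_i)`:
then `aᵢᵀ M_{S_i}(T) bᵢ = ⟨g_i h_i, T⟩ := Σ_m conj((g_ih_i)_m) T_m` (entrywise product rule and
pair reindexing from `StableRankCancellationSmlPairs.lean`), `Σ_i ⟨g_i h_i, T⟩ = ‖T‖²`, and
`‖a_i‖² ‖b_i‖² = ‖g_i h_i‖²`. With `x_i = |⟨g_ih_i,T⟩|`, `w_i = ‖g_ih_i‖²`, pick `i` maximising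
`x_i²/w_i = ρ`; then `x_j² ≤ ρ w_j` for all `j`, so `‖T‖² ≤ Σ x_j ≤ √ρ Σ √w_j ≤ √ρ √(|ι| Σ w_j)`
(Cauchy–Schwarz), i.e. `‖T‖⁴ w_i ≤ |ι| (Σ w_j) x_i²`.

* `spikeLemma_proof : SpikeLemma` — the item, verbatim.

Honest framing: an unconditional inequality filed as route bookkeeping (the route's cruxes are
open); nothing here is progress on VP ≠ VNP.

## References

* N. Limaye, S. Srinivasan, S. Tavenas, *Superpolynomial lower bounds against low-depth algebraic
  circuits*, J. ACM 2025, §2.1 (the matrices `M_w`, relative rank). [cite: LimayeSrinivasanTavenas2025, §2.1]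
* N. Nisan, *Lower bounds for non-commutative computation*, STOC 1991 (partial-derivative / cut
  matrices as the measure). [cite: Nisan1991Noncommutative, §2]
-/

set_option linter.dupNamespace false

noncomputable section

open Finset MvPolynomial

namespace Summit.ValiantsHypothesis.ValiantsHypothesis.Theorems.StableRankCancellationSpike

open Literature.Computability.AlgebraicComplexity StableRankCancellationSml
open scoped ComplexConjugate

/-- **The selection step** (real inequality): if `N ≤ Σ_j x_j`, `0 < N`, `0 ≤ x_j`, `0 ≤ w_j` and
`x_j = 0` whenever `w_j = 0`, then some `i` has `x_i ≠ 0` and `N² w_i ≤ |ι| (Σ_j w_j) x_i²`.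
[folklore] -/
theorem exists_spike {ι : Type*} [Fintype ι] (x w : ι → ℝ) (N : ℝ) (hN : 0 < N)
    (hle : N ≤ ∑ j, x j) (hx : ∀ j, 0 ≤ x j) (hw : ∀ j, 0 ≤ w j)
    (hxw : ∀ j, w j = 0 → x j = 0) :
    ∃ i, x i ≠ 0 ∧ N ^ 2 * w i ≤ (Fintype.card ι : ℝ) * (∑ j, w j) * x i ^ 2 := by
  classical
  -- `ι` is nonempty, else `Σ x = 0 < N`
  have hne : (univ : Finset ι).Nonempty := by
    by_contra h
    rw [not_nonempty_iff_eq_empty] at h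
    rw [h] at hle
    · simp at hle; linarith
  obtain ⟨i, _, hi⟩ := exists_max_image univ (fun j => x j ^ 2 / w j) hne
  set ρ := x i ^ 2 / w i with hρ
  have hρ0 : 0 ≤ ρ := div_nonneg (sq_nonneg _) (hw i)
  -- `x_j² ≤ ρ w_j` for all `j`
  have hdom : ∀ j, x j ^ 2 ≤ ρ * w j := by
    intro j
    rcases (hw j).eq_or_lt with h0 | hpos
    · rw [← h0, hxw j h0.symm]; simp
    · have := hi j (mem_univ j)
      rwa [div_le_iff₀ hpos] at this
  -- `x_j ≤ √ρ √w_j`, sum, Cauchy–Schwarz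
  have hxle : ∀ j, x j ≤ Real.sqrt ρ * Real.sqrt (w j) := by
    intro j
    rw [← Real.sqrt_mul hρ0, ← Real.sqrt_sq (hx j)]
    exact Real.sqrt_le_sqrt (hdom j)
  have hsum : ∑ j, x j ≤ Real.sqrt ρ * ∑ j, Real.sqrt (w j) := by
    rw [mul_sum]; exact sum_le_sum fun j _ => hxle j
  have hCS : (∑ j, Real.sqrt (w j)) ^ 2 ≤ (Fintype.card ι : ℝ) * ∑ j, w j := by
    have h := sum_mul_sq_le_sq_mul_sq (univ : Finset ι) (fun _ => (1 : ℝ)) (fun j => Real.sqrt (w j))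
    simp only [one_mul, one_pow, sum_const, card_univ, nsmul_eq_mul, mul_one] at h
    calc (∑ j, Real.sqrt (w j)) ^ 2 ≤ (Fintype.card ι : ℝ) * ∑ j, Real.sqrt (w j) ^ 2 := h
      _ = (Fintype.card ι : ℝ) * ∑ j, w j := by
          congr 1; exact sum_congr rfl fun j _ => Real.sq_sqrt (hw j)
  have hN2 : N ^ 2 ≤ ρ * ((Fintype.card ι : ℝ) * ∑ j, w j) := by
    have h1 : N ≤ Real.sqrt ρ * ∑ j, Real.sqrt (w j) := hle.trans hsum
    have h2 : N ^ 2 ≤ (Real.sqrt ρ * ∑ j, Real.sqrt (w j)) ^ 2 := pow_le_pow_left₀ hN.le h1 2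
    calc N ^ 2 ≤ (Real.sqrt ρ * ∑ j, Real.sqrt (w j)) ^ 2 := h2
      _ = ρ * (∑ j, Real.sqrt (w j)) ^ 2 := by rw [mul_pow, Real.sq_sqrt hρ0]
      _ ≤ ρ * ((Fintype.card ι : ℝ) * ∑ j, w j) := mul_le_mul_of_nonneg_left hCS hρ0
  -- `w_i > 0` and `x_i ≠ 0`, else `ρ = 0` and `N² ≤ 0`
  have hwi : 0 < w i := by
    rcases (hw i).eq_or_lt with h0 | hpos
    · exfalso
      have : ρ = 0 := by rw [hρ, ← h0, div_zero]
      rw [this, zero_mul] at hN2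
      nlinarith
    · exact hpos
  have hxi : x i ≠ 0 := by
    intro h0
    have : ρ = 0 := by rw [hρ, h0]; simp
    rw [this, zero_mul] at hN2
    nlinarith
  refine ⟨i, hxi, ?_⟩
  calc N ^ 2 * w i ≤ ρ * ((Fintype.card ι : ℝ) * ∑ j, w j) * w i :=
        mul_le_mul_of_nonneg_right hN2 (hw i)
    _ = (Fintype.card ι : ℝ) * (∑ j, w j) * x i ^ 2 := by
        rw [hρ]; field_simp

section Pieces

variable {d : ℕ} {α : Type} [Fintype α] [DecidableEq α]

/-- **(1)** The bilinear form of `M_S(T)` at the conjugate coefficient vectors of `g` (over `S`)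
and `h` (over `Sᶜ`) is the inner product `⟨g h, T⟩ = Σ_m conj((gh)_m) T_m`.
[cite: LimayeSrinivasanTavenas2025, §2.1] -/
theorem bil_conj_eq_inner (S : Finset (Fin d)) {g h : MvPolynomial (Σ _ : Fin d, α) ℂ}
    (hg : IsSetMultilinear Sigma.fst S g) (hh : IsSetMultilinear Sigma.fst Sᶜ h)
    (T : MvPolynomial (Σ _ : Fin d, α) ℂ) :
    ∑ r : Assignment (fun _ : Fin d => α) S, ∑ c : Assignment (fun _ : Fin d => α) Sᶜ,
        conj (coeff (assignMonomial S r) g) * coeffMat ℂ S Sᶜ T r c *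
          conj (coeff (assignMonomial Sᶜ c) h) =
      ∑ m ∈ T.support, conj (coeff m (g * h)) * coeff m T := by
  classical
  have hdisj : Disjoint S Sᶜ := Finset.disjoint_left.2 fun x hx hxc => (Finset.mem_compl.1 hxc) hx
  have hgh : IsSetMultilinear Sigma.fst (S ∪ Sᶜ) (g * h) :=
    IsSetMultilinear.mul Sigma.fst hg hh hdisj
  rw [inner_eq_sum_pairs hdisj hgh T]
  refine sum_congr rfl fun r _ => sum_congr rfl fun c _ => ?_
  rw [coeffMat_apply, coeff_add_mul_of_isSetMultilinear hdisj hg hh, map_mul]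
  ring

/-- **(3)** `‖conj coeff(g)‖² · ‖conj coeff(h)‖² = ‖g h‖²` (sum of squared moduli of the
coefficients). [cite: LimayeSrinivasanTavenas2025, §2.1] -/
theorem normSq_conj_mul (S : Finset (Fin d)) {g h : MvPolynomial (Σ _ : Fin d, α) ℂ}
    (hg : IsSetMultilinear Sigma.fst S g) (hh : IsSetMultilinear Sigma.fst Sᶜ h) :
    (∑ r : Assignment (fun _ : Fin d => α) S, ‖conj (coeff (assignMonomial S r) g)‖ ^ 2) *
        (∑ c : Assignment (fun _ : Fin d => α) Sᶜ, ‖conj (coeff (assignMonomial Sᶜ c) h)‖ ^ 2) =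
      ∑ m ∈ (g * h).support, ‖coeff m (g * h)‖ ^ 2 := by
  classical
  have hdisj : Disjoint S Sᶜ := Finset.disjoint_left.2 fun x hx hxc => (Finset.mem_compl.1 hxc) hx
  have hgh : IsSetMultilinear Sigma.fst (S ∪ Sᶜ) (g * h) :=
    IsSetMultilinear.mul Sigma.fst hg hh hdisj
  rw [normSq_eq_sum_pairs hdisj hgh, sum_mul_sum]
  refine sum_congr rfl fun r _ => sum_congr rfl fun c _ => ?_
  rw [coeff_add_mul_of_isSetMultilinear hdisj hg hh, norm_mul, mul_pow,
    Complex.norm_conj, Complex.norm_conj]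

omit [Fintype α] [DecidableEq α] in
/-- **(2)** `Σ_i ⟨p_i, T⟩ = ‖T‖²` for `T = Σ_i p_i`. [folklore] -/
theorem sum_inner_eq_normSq {ι : Type} [Fintype ι] (p : ι → MvPolynomial (Σ _ : Fin d, α) ℂ) :
    ∑ i, ∑ m ∈ (∑ i, p i).support, conj (coeff m (p i)) * coeff m (∑ i, p i) =
      ((∑ m ∈ (∑ i, p i).support, ‖coeff m (∑ i, p i)‖ ^ 2 : ℝ) : ℂ) := by
  rw [sum_comm, Complex.ofReal_sum]
  refine sum_congr rfl fun m _ => ?_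
  rw [← sum_mul, ← map_sum, ← coeff_sum, ← Complex.normSq_eq_norm_sq,
    Complex.normSq_eq_conj_mul_self]

omit [Fintype α] [DecidableEq α] in
/-- A nonzero polynomial has positive coefficient norm. [folklore] -/
theorem normSq_pos_of_ne_zero {p : MvPolynomial (Σ _ : Fin d, α) ℂ} (hp : p ≠ 0) :
    0 < ∑ m ∈ p.support, ‖coeff m p‖ ^ 2 := by
  obtain ⟨m, hm⟩ := exists_coeff_ne_zero hp
  exact lt_of_lt_of_le (by positivity : (0 : ℝ) < ‖coeff m p‖ ^ 2)
    (single_le_sum (f := fun m => ‖coeff m p‖ ^ 2) (fun m _ => by positivity)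
      (mem_support_iff.2 hm))

end Pieces

/-- **Route StableRankCancellation, item `SpikeLemma` (stmt-ValiantsHypothesis-10614).**
[cite: LimayeSrinivasanTavenas2025, §2.1] [cite: Nisan1991Noncommutative, §2] -/
theorem spikeLemma_proof : Theses.StableRankCancellation.SpikeLemma := by
  intro d α _ _ ι _ S g h hsml hT
  classical
  -- real data
  have hNpos := normSq_pos_of_ne_zero hT
  have hxw : ∀ j, (∑ m ∈ (g j * h j).support, ‖coeff m (g j * h j)‖ ^ 2) = 0 →
      ‖∑ m ∈ (∑ i, g i * h i).support, conj (coeff m (g j * h j)) * coeff m (∑ i, g i * h i)‖ = 0 := by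
    intro j hj
    have hzero : g j * h j = 0 := by
      by_contra hne
      have := normSq_pos_of_ne_zero hne
      linarith
    simp only [hzero, coeff_zero, map_zero, zero_mul, sum_const_zero, norm_zero]
  have hNle : (∑ m ∈ (∑ i, g i * h i).support, ‖coeff m (∑ i, g i * h i)‖ ^ 2) ≤
      ∑ j, ‖∑ m ∈ (∑ i, g i * h i).support,
        conj (coeff m (g j * h j)) * coeff m (∑ i, g i * h i)‖ := by
    have h1 := congrArg (fun z : ℂ => ‖z‖) (sum_inner_eq_normSq (fun i => g i * h i))
    simp only [Complex.norm_real, Real.norm_of_nonneg hNpos.le] at h1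
    rw [← h1]
    exact norm_sum_le _ _
  obtain ⟨i, hxi, hineq⟩ := exists_spike
    (fun j => ‖∑ m ∈ (∑ i, g i * h i).support,
      conj (coeff m (g j * h j)) * coeff m (∑ i, g i * h i)‖)
    (fun j => ∑ m ∈ (g j * h j).support, ‖coeff m (g j * h j)‖ ^ 2) _ hNpos hNle
    (fun j => norm_nonneg _) (fun j => sum_nonneg fun _ _ => by positivity) hxw
  refine ⟨i, fun r => conj (coeff (assignMonomial (S i) r) (g i)),
    fun c => conj (coeff (assignMonomial (S i)ᶜ c) (h i)), ?_, ?_⟩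
  · rw [bil_conj_eq_inner (S i) (hsml i).1 (hsml i).2]
    intro h0
    exact hxi (by simp only [h0, norm_zero])
  · rw [bil_conj_eq_inner (S i) (hsml i).1 (hsml i).2, mul_assoc (_ ^ 2),
      normSq_conj_mul (S i) (hsml i).1 (hsml i).2]
    exact hineq

end Summit.ValiantsHypothesis.ValiantsHypothesis.Theorems.StableRankCancellationSpike

end
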